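import Summits.Parity.BatemanHorn.Theorems.SoloInformedTwinCRTCount

/-!
# SoloInformedTwinPairSum — the located twin sum in divisor-pair coordinates

Solo unit `solo-Parity-informed` (ideation tier, informed mode), session 40; `paper.md` §20 (proof of
Theorems 20.1/20.2, first display), `PLAN.md` §41.2 / §44, CLAIMS C118.

The kernel theorem `twinPrime_isEquivalent_iff_tail_isLittleO` (`SoloInformedTwinPrimeLocalisation`,
C89) states the Hardy–Littlewood twin prime asymptotic as
`∑_{n ≤ x} ∑_{e ∣ n(n+2), e > y} μ(e) log² e = o(x)` (`y = ⌊x^{1-ε}⌋`).  Every analytic treatment of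
such sums begins with the same elementary re-indexing, recorded here once (no analytic input):

* odd `n`: `gcd(n, n+2) = 1`, so the divisors of `n(n+2)` are exactly the products `e₁e₂`,
  `e₁ ∣ n`, `e₂ ∣ n+2` (`sum_divisors_mul_add_two_of_odd`), whence
  `∑_{n ≤ x odd} ∑_{e ∣ n(n+2)} g(e) = ∑_{e₁,e₂ ≤ x+2} g(e₁e₂) · #{n ≤ x odd : e₁ ∣ n, e₂ ∣ n+2}`
  (`sum_odd_sum_divisors_eq_sum_pairs`);
* even `n = 2m`: for `g` vanishing off the squarefree numbers (as `μ · w` does) the divisors of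
  `n(n+2) = 4m(m+1)` that matter are those of `m(m+1)`, and `gcd(m, m+1) = 1`
  (`sum_divisors_two_mul_eq`, `sum_divisors_mul_add_one`), whence
  `∑_{n ≤ x even} ∑_{e ∣ n(n+2)} g(e) = ∑_{e₁,e₂ ≤ x+2} g(e₁e₂) · #{m ≤ x/2 : e₁ ∣ m, e₂ ∣ m+1}`
  (`sum_even_sum_divisors_eq_sum_pairs`);
* assembly (`twinLocatedSum_eq_sum_pairs`): the located twin sum equals
  `∑_{e₁,e₂ ≤ x+2} 𝟙[e₁e₂ > y] μ(e₁)μ(e₂) log²(e₁e₂) · (N_odd(e₁,e₂;x) + N_even(e₁,e₂;x/2))`,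
  where by `SoloInformedTwinCRTCount` each count is a residue-class count
  `x'/Q − (ρ/Q − 1/2) − ψ((x'−ρ)/Q)` with Kloosterman fraction `ρ/Q ≡ 1/2 − ē/e₂` resp. `−ē/e₂`.

Nothing here is specific to the cut `e > y`: `g` is arbitrary (supported on squarefree numbers for
the even part).  Deliberately NOT here: any estimate (paper.md §20).
-/

namespace Summit.Parity.BatemanHorn.Theorems

open Finset ArithmeticFunction
open scoped ArithmeticFunction.Moebius


/-! ### 1. Re-indexing divisor sums of `n(n+2)` over divisor pairs -/

/-- For odd `n` the divisor sums of `n(n+2)` factor over pairs `(e₁ ∣ n, e₂ ∣ n+2)`. -/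
theorem sum_divisors_mul_add_two_of_odd {n : ℕ} (hn : Odd n) (g : ℕ → ℝ) :
    ∑ e ∈ (n * (n + 2)).divisors, g e = ∑ e₁ ∈ n.divisors, ∑ e₂ ∈ (n + 2).divisors, g (e₁ * e₂) := by
  rw [Nat.divisors_mul, Finset.mul_def,
    Finset.sum_image (fun a ha b hb hab => (coprime_add_two_of_odd hn).mul_injOn_divisors ha hb hab),
    Finset.sum_product]

/-- The divisor sums of `m(m+1)` factor over pairs `(e₁ ∣ m, e₂ ∣ m+1)`. -/
theorem sum_divisors_mul_add_one (m : ℕ) (g : ℕ → ℝ) :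
    ∑ e ∈ (m * (m + 1)).divisors, g e = ∑ e₁ ∈ m.divisors, ∑ e₂ ∈ (m + 1).divisors, g (e₁ * e₂) := by
  rw [Nat.divisors_mul, Finset.mul_def,
    Finset.sum_image (fun a ha b hb hab =>
      (Nat.coprime_self_add_right.mpr (Nat.coprime_one_right m)).mul_injOn_divisors ha hb hab),
    Finset.sum_product]

/-- A squarefree divisor of `4N`, `N` even, divides `N`. -/
theorem dvd_of_squarefree_of_dvd_four_mul {e N : ℕ} (he : Squarefree e) (hN : Even N)
    (h : e ∣ 4 * N) : e ∣ N := by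
  rw [← he.dvd_pow_iff_dvd (n := 3) (by norm_num)]
  obtain ⟨t, rfl⟩ := hN
  exact h.trans ⟨t * t, by ring⟩

/-- For `m ≥ 1` and `g` vanishing off the squarefree numbers, the divisor sum of
`(2m)(2m+2) = 4m(m+1)` equals that of `m(m+1)`. -/
theorem sum_divisors_two_mul_eq {m : ℕ} (hm : 0 < m) {g : ℕ → ℝ}
    (hg : ∀ e, ¬Squarefree e → g e = 0) :
    ∑ e ∈ (2 * m * (2 * m + 2)).divisors, g e = ∑ e ∈ (m * (m + 1)).divisors, g e := by
  have h4 : 2 * m * (2 * m + 2) = 4 * (m * (m + 1)) := by ring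
  rw [h4]
  symm
  refine sum_subset (Nat.divisors_subset_of_dvd (by positivity) (Dvd.intro_left 4 rfl))
    fun e he hne => ?_
  refine hg e fun hsq => hne ?_
  rw [Nat.mem_divisors] at he ⊢
  exact ⟨dvd_of_squarefree_of_dvd_four_mul hsq (Nat.even_mul_succ_self m) he.1, by positivity⟩

/-- Swapping the sums: `∑_{n ∈ S} ∑_{e₁ ∣ a(n)} ∑_{e₂ ∣ b(n)} g(e₁e₂)
  = ∑_{e₁ ≤ B} ∑_{e₂ ≤ B} g(e₁e₂) · #{n ∈ S : e₁ ∣ a(n), e₂ ∣ b(n)}` when `0 < a(n), b(n) ≤ B` on `S`. -/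
theorem sum_sum_divisors_sum_divisors_eq_sum_pairs (S : Finset ℕ) (a b : ℕ → ℕ) (B : ℕ)
    (ha : ∀ n ∈ S, 0 < a n ∧ a n ≤ B) (hb : ∀ n ∈ S, 0 < b n ∧ b n ≤ B) (g : ℕ → ℝ) :
    ∑ n ∈ S, ∑ e₁ ∈ (a n).divisors, ∑ e₂ ∈ (b n).divisors, g (e₁ * e₂)
      = ∑ e₁ ∈ Icc 1 B, ∑ e₂ ∈ Icc 1 B, g (e₁ * e₂) * #{n ∈ S | e₁ ∣ a n ∧ e₂ ∣ b n} := by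
  have hdiv : ∀ N, 0 < N → N ≤ B → N.divisors = (Icc 1 B).filter (· ∣ N) := by
    intro N hN hNB
    ext e
    simp only [Nat.mem_divisors, mem_filter, mem_Icc]
    constructor
    · rintro ⟨hd, _⟩
      exact ⟨⟨Nat.pos_of_dvd_of_pos hd hN, (Nat.le_of_dvd hN hd).trans hNB⟩, hd⟩
    · rintro ⟨_, hd⟩
      exact ⟨hd, hN.ne'⟩
  have h1 : ∀ n ∈ S, ∑ e₁ ∈ (a n).divisors, ∑ e₂ ∈ (b n).divisors, g (e₁ * e₂)
      = ∑ e₁ ∈ Icc 1 B, ∑ e₂ ∈ Icc 1 B, if e₁ ∣ a n ∧ e₂ ∣ b n then g (e₁ * e₂) else 0 := by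
    intro n hn
    rw [hdiv (a n) (ha n hn).1 (ha n hn).2, hdiv (b n) (hb n hn).1 (hb n hn).2, sum_filter]
    refine sum_congr rfl fun e₁ _ => ?_
    by_cases h : e₁ ∣ a n
    · rw [if_pos h, sum_filter]
      exact sum_congr rfl fun e₂ _ => by simp [h]
    · rw [if_neg h]
      exact (sum_eq_zero fun e₂ _ => by simp [h]).symm
  rw [sum_congr rfl h1, sum_comm]
  refine sum_congr rfl fun e₁ _ => ?_
  rw [sum_comm]
  refine sum_congr rfl fun e₂ _ => ?_
  rw [← sum_filter, sum_const, nsmul_eq_mul, mul_comm]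

/-- **Odd part over pairs.**
`∑_{n ≤ x odd} ∑_{e ∣ n(n+2)} g(e) = ∑_{e₁, e₂ ≤ x+2} g(e₁e₂) · #{n ≤ x odd : e₁ ∣ n, e₂ ∣ n+2}`. -/
theorem sum_odd_sum_divisors_eq_sum_pairs (x : ℕ) (g : ℕ → ℝ) :
    ∑ n ∈ (Icc 1 x).filter Odd, ∑ e ∈ (n * (n + 2)).divisors, g e
      = ∑ e₁ ∈ Icc 1 (x + 2), ∑ e₂ ∈ Icc 1 (x + 2),
          g (e₁ * e₂) * #{n ∈ (Icc 1 x).filter Odd | e₁ ∣ n ∧ e₂ ∣ n + 2} := by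
  rw [sum_congr rfl fun n hn => sum_divisors_mul_add_two_of_odd (mem_filter.mp hn).2 g]
  refine sum_sum_divisors_sum_divisors_eq_sum_pairs _ (fun n => n) (fun n => n + 2) (x + 2)
    (fun n hn => ?_) (fun n hn => ?_) g
  · have := mem_Icc.mp (mem_filter.mp hn).1
    exact ⟨this.1, by omega⟩
  · have := mem_Icc.mp (mem_filter.mp hn).1
    exact ⟨by omega, by omega⟩

/-- **Even part over pairs** (`g` vanishing off the squarefree numbers).
`∑_{n ≤ x even} ∑_{e ∣ n(n+2)} g(e) = ∑_{e₁, e₂ ≤ x+2} g(e₁e₂) · #{m ≤ x/2 : e₁ ∣ m, e₂ ∣ m+1}`. -/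
theorem sum_even_sum_divisors_eq_sum_pairs (x : ℕ) {g : ℕ → ℝ}
    (hg : ∀ e, ¬Squarefree e → g e = 0) :
    ∑ n ∈ (Icc 1 x).filter Even, ∑ e ∈ (n * (n + 2)).divisors, g e
      = ∑ e₁ ∈ Icc 1 (x + 2), ∑ e₂ ∈ Icc 1 (x + 2),
          g (e₁ * e₂) * #{m ∈ Icc 1 (x / 2) | e₁ ∣ m ∧ e₂ ∣ m + 1} := by
  have hmap : (Icc 1 x).filter Even
      = (Icc 1 (x / 2)).map ⟨(2 * ·), mul_right_injective₀ two_ne_zero⟩ := by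
    ext n
    simp only [mem_filter, mem_Icc, mem_map, Function.Embedding.coeFn_mk]
    constructor
    · rintro ⟨⟨h1, hx⟩, ⟨t, rfl⟩⟩
      exact ⟨t, ⟨by omega, by omega⟩, by omega⟩
    · rintro ⟨t, ⟨h1, ht⟩, rfl⟩
      exact ⟨⟨by omega, by omega⟩, ⟨t, by ring⟩⟩
  rw [hmap, sum_map]
  simp only [Function.Embedding.coeFn_mk]
  rw [sum_congr rfl fun m hm => by
    rw [sum_divisors_two_mul_eq (by have := mem_Icc.mp hm; omega) hg, sum_divisors_mul_add_one]]
  refine sum_sum_divisors_sum_divisors_eq_sum_pairs _ (fun m => m) (fun m => m + 1) (x + 2)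
    (fun m hm => ?_) (fun m hm => ?_) g
  · have := mem_Icc.mp hm
    exact ⟨this.1, by omega⟩
  · have := mem_Icc.mp hm
    exact ⟨by omega, by omega⟩

/-! ### 2. Assembly: the located twin sum over pairs -/

/-- Splitting a sum over `[1, x]` by parity. -/
theorem sum_Icc_eq_sum_odd_add_sum_even (x : ℕ) (F : ℕ → ℝ) :
    ∑ n ∈ Icc 1 x, F n = ∑ n ∈ (Icc 1 x).filter Odd, F n + ∑ n ∈ (Icc 1 x).filter Even, F n := by
  rw [← sum_filter_add_sum_filter_not (Icc 1 x) Odd]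
  congr 1
  exact sum_congr (filter_congr fun n _ => Nat.not_odd_iff_even) fun _ _ => rfl

/-- **The located twin sum over divisor pairs.**  For every `x, y`:
`∑_{n ≤ x} ∑_{e ∣ n(n+2), e > y} μ(e) log² e
   = ∑_{e₁, e₂ ≤ x+2} 𝟙[e₁e₂ > y] μ(e₁) μ(e₂) log²(e₁e₂) ·
       (#{n ≤ x odd : e₁ ∣ n, e₂ ∣ n+2} + #{m ≤ x/2 : e₁ ∣ m, e₂ ∣ m+1})`
(non-coprime pairs contribute nothing: both counts vanish). -/
theorem twinLocatedSum_eq_sum_pairs (x y : ℕ) :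
    ∑ n ∈ Icc 1 x, ∑ e ∈ (n * (n + 2)).divisors with y < e, (μ e : ℝ) * Real.log e ^ 2
      = ∑ e₁ ∈ Icc 1 (x + 2), ∑ e₂ ∈ Icc 1 (x + 2),
          (if y < e₁ * e₂ then (μ e₁ : ℝ) * μ e₂ * Real.log (e₁ * e₂ : ℕ) ^ 2 else 0) *
            ((#{n ∈ (Icc 1 x).filter Odd | e₁ ∣ n ∧ e₂ ∣ n + 2} : ℝ)
              + #{m ∈ Icc 1 (x / 2) | e₁ ∣ m ∧ e₂ ∣ m + 1}) := by
  set g : ℕ → ℝ := fun e => if y < e then (μ e : ℝ) * Real.log e ^ 2 else 0 with hg_def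
  have hg : ∀ e, ¬Squarefree e → g e = 0 := fun e he => by
    simp [hg_def, ArithmeticFunction.moebius_eq_zero_of_not_squarefree he]
  have hL : ∑ n ∈ Icc 1 x, ∑ e ∈ (n * (n + 2)).divisors with y < e, (μ e : ℝ) * Real.log e ^ 2
      = ∑ n ∈ Icc 1 x, ∑ e ∈ (n * (n + 2)).divisors, g e := by
    refine sum_congr rfl fun n _ => ?_
    rw [sum_filter]
  rw [hL, sum_Icc_eq_sum_odd_add_sum_even, sum_odd_sum_divisors_eq_sum_pairs,
    sum_even_sum_divisors_eq_sum_pairs x hg, ← sum_add_distrib]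
  refine sum_congr rfl fun e₁ _ => ?_
  rw [← sum_add_distrib]
  refine sum_congr rfl fun e₂ _ => ?_
  rw [← mul_add]
  by_cases hc : Nat.Coprime e₁ e₂
  · simp only [hg_def, ArithmeticFunction.isMultiplicative_moebius.map_mul_of_coprime hc, Int.cast_mul]
  · have hA : #{n ∈ (Icc 1 x).filter Odd | e₁ ∣ n ∧ e₂ ∣ n + 2} = 0 :=
      card_eq_zero.mpr (filter_eq_empty_iff.mpr fun n hn h =>
        hc (odd_odd_coprime_of_dvd (mem_filter.mp hn).2 h.1 h.2).2.2)
    have hB : #{m ∈ Icc 1 (x / 2) | e₁ ∣ m ∧ e₂ ∣ m + 1} = 0 :=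
      card_eq_zero.mpr (filter_eq_empty_iff.mpr fun m _ h =>
        hc (coprime_of_dvd_of_dvd_add_one h.1 h.2))
    rw [hA, hB]
    simp

end Summit.Parity.BatemanHorn.Theorems
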